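import Summits.RiemannHypothesis.RiemannHypothesis.Theorems.WeilFormatCWindowDictionary
import HarnessLib

/-!
# Format C, design C∞ (L2 backbone): the window dictionary beyond `K(a)` — summable Fourier coefficients suffice

Route context: Fourier–Galerkin / Schur-complement certificates of Weil positivity on a window ("format C";
cell memo `run/shared/lean/pub/rh-explicit/rh-explicit-weil-10/FORMATC-DESIGN.md` §9.12.11; supporting
stmt-RiemannHypothesis-0098; seat rh-explicit-weil-10).  The deflated certificate of design C∞ enlarges the Fourier block by a few
window POLYNOMIALS `p·𝟙_{[−a,a]}` (measured: 6–8 per sector carry the whole cost factor, FORMATC-DESIGN §9.12.11).  These are NOT in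
Yoshida's `K(a)` (their `2a`-periodisation is not smooth), so `WeilFormatCWindowDictionary.tendsto_weilWindowForm_proj` does not
apply as stated.  Its proof, however, uses `φ ∈ K(a)` only through (i) continuity of `φ` on the closed window with `φ(−a) = φ(a)`,
(ii) `Σ_n |c_n(φ)| < ∞` and (iii) `Σ_n |n|·|c_n(φ)| < ∞` — true for every window polynomial whose periodisation is `C¹`
(`c_n = O(|n|^{-3})`).  This file records the dictionary under exactly these hypotheses:

* `hasSum_fourierCoeff_mul_cexp_of_summable` — pointwise Fourier inversion on the closed window from (i)+(ii)
  (Mathlib's `has_pointwise_sum_fourier_series_of_summable` on `AddCircle (2a)`);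
* `norm_sub_trigPoly_le_of_summable` — `‖φ(x) − p_N(x)‖ ≤ Σ_{|n|>N} (2a)^{-1}|c_n|` on the window;
* `tendsto_weilWindowForm_proj_of_summable` — `weilWindowForm a (proj a N φ) → weilWindowForm a φ` from (i)–(iii) and
  `φ = 0` off the window (via `WeilFormatCWindowLimit.tendsto_weilWindowForm_of_uniform`).

Pure bookkeeping over the tree's window analysis; standard axioms; no RH claim.
-/

set_option autoImplicit false
-- `Summit.RiemannHypothesis.RiemannHypothesis.…` is the layout-mandated namespace (summit = problem name).
set_option linter.dupNamespace false

noncomputable section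

open Complex Filter Set MeasureTheory
open scoped Real Topology ComplexConjugate

namespace Summit.RiemannHypothesis.RiemannHypothesis.Theorems.WeilFormatC

open Literature.NumberTheory.LFunctions
open Literature.NumberTheory.LFunctions.Yoshida1992 (modes chi proj trigPoly trigPolyDeriv
  proj_apply_of_mem proj_apply_of_not_mem proj_apply_eq_indicator_trigPoly norm_trigPoly_le
  norm_trigPoly_sub_le norm_trigPolyDeriv_le tendsto_tsum_compl_modes)

variable {a : ℝ} {φ : ℝ → ℂ}

/-- The character `x ↦ e^{iπnx/a}` has norm one. -/
theorem norm_cexp_window_character (a : ℝ) (n : ℤ) (x : ℝ) : ‖cexp (π * I * n * x / a)‖ = 1 := by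
  have : (π * I * n * x / a : ℂ) = ((π * n * x / a : ℝ) : ℂ) * I := by
    push_cast
    ring
  rw [this, Complex.norm_exp_ofReal_mul_I]

/-- **Fourier inversion on the closed window, summable class.**  If `φ` is continuous on `[−a, a]` with
`φ(−a) = φ(a)` (`a > 0`) and its window Fourier coefficients are absolutely summable, then
`Σ_{n∈ℤ} (2a)^{-1} c_n(φ) e^{iπnx/a} = φ(x)` for every `|x| ≤ a`. -/
theorem hasSum_fourierCoeff_mul_cexp_of_summable (ha : 0 < a) (hcont : ContinuousOn φ (Icc (-a) a))
    (hend : φ (-a) = φ a) (hsum : Summable fun n : ℤ ↦ ‖Yoshida1992.fourierCoeff a n φ‖)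
    {x : ℝ} (hx : x ∈ Icc (-a) a) :
    HasSum (fun n : ℤ ↦ Yoshida1992.fourierCoeff a n φ / (2 * a) * cexp (π * I * n * x / a)) (φ x) := by
  haveI hT : Fact (0 < 2 * a) := ⟨by positivity⟩
  have hfa : φ (-a) = φ (-a + 2 * a) := by rw [show -a + 2 * a = a by ring, hend]
  have hcont' : ContinuousOn φ (Icc (-a) (-a + 2 * a)) := by rwa [show -a + 2 * a = a by ring]
  -- the continuous function on the circle obtained by gluing the window at `±a`
  let F : C(AddCircle (2 * a), ℂ) :=
    ⟨AddCircle.liftIco (2 * a) (-a) φ, AddCircle.liftIco_continuous hfa hcont'⟩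
  have hF : ∀ y ∈ Icc (-a) a, F (y : AddCircle (2 * a)) = φ y := by
    intro y hy
    rcases eq_or_lt_of_le hy.2 with heq | hlt
    · rw [heq]
      have e : ((a : ℝ) : AddCircle (2 * a)) = ((-a : ℝ) : AddCircle (2 * a)) := by
        have h := AddCircle.coe_add_period (2 * a) (-a)
        rwa [show -a + 2 * a = a by ring] at h
      show AddCircle.liftIco (2 * a) (-a) φ (a : AddCircle (2 * a)) = φ a
      rw [e, AddCircle.liftIco_coe_apply ⟨le_rfl, by linarith⟩, hend]
    · show AddCircle.liftIco (2 * a) (-a) φ (y : AddCircle (2 * a)) = φ y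
      exact AddCircle.liftIco_coe_apply ⟨hy.1, by linarith⟩
  -- its Fourier coefficients are `(2a)^{-1} c_n(φ)`
  have hcoef : ∀ n : ℤ, _root_.fourierCoeff (F : AddCircle (2 * a) → ℂ) n =
      Yoshida1992.fourierCoeff a n φ / (2 * a) := by
    intro n
    rw [fourierCoeff_eq_intervalIntegral _ n (-a), show -a + 2 * a = a by ring]
    have hint : ∫ y in (-a)..a, (fourier (-n)) (y : AddCircle (2 * a)) • F (y : AddCircle (2 * a))
        = ∫ y in (-a)..a, φ y * cexp (-(π * I * n * y / a)) := by
      refine intervalIntegral.integral_congr fun y hy ↦ ?_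
      rw [uIcc_of_le (by linarith)] at hy
      rw [smul_eq_mul, hF y hy, fourier_coe_apply, mul_comm]
      congr 1
      congr 1
      push_cast
      field_simp
    rw [hint, Yoshida1992.fourierCoeff]
    rw [Complex.real_smul]
    push_cast
    ring
  have hsumF : Summable (_root_.fourierCoeff (F : AddCircle (2 * a) → ℂ)) := by
    refine Summable.of_norm ?_
    simp_rw [hcoef, norm_div]
    have : ‖((2 : ℂ) * a)‖ = 2 * a := by
      rw [show ((2 : ℂ) * a) = ((2 * a : ℝ) : ℂ) by push_cast; ring, Complex.norm_real,
        Real.norm_of_nonneg (by positivity)]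
    simp_rw [this]
    exact hsum.div_const _
  have hpt := has_pointwise_sum_fourier_series_of_summable hsumF (x : AddCircle (2 * a))
  rw [hF x hx] at hpt
  convert hpt using 1
  ext n
  rw [hcoef, fourier_coe_apply, smul_eq_mul]
  congr 1
  congr 1
  push_cast
  field_simp

/-- **Uniform approximation by the truncated Fourier series, summable class**: for `|x| ≤ a`,
`‖φ(x) − p_N(x)‖ ≤ Σ_{|n| > N} (2a)^{-1} |c_n(φ)|`. -/
theorem norm_sub_trigPoly_le_of_summable (ha : 0 < a) (hcont : ContinuousOn φ (Icc (-a) a))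
    (hend : φ (-a) = φ a) (hsum : Summable fun n : ℤ ↦ ‖Yoshida1992.fourierCoeff a n φ‖)
    (N : ℕ) {x : ℝ} (hx : x ∈ Icc (-a) a) :
    ‖φ x - trigPoly a N φ x‖ ≤ ∑' n : {n // n ∉ modes N}, ‖Yoshida1992.fourierCoeff a n φ‖ / (2 * a) := by
  have hf := hasSum_fourierCoeff_mul_cexp_of_summable ha hcont hend hsum hx
  have hcompl := ((modes N).hasSum_iff_compl).1 hf
  have hnorm : ∀ n : ℤ, ‖Yoshida1992.fourierCoeff a n φ / (2 * a) * cexp (π * I * n * x / a)‖ =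
      ‖Yoshida1992.fourierCoeff a n φ‖ / (2 * a) := by
    intro n
    rw [norm_mul, norm_cexp_window_character, mul_one, norm_div]
    congr 1
    rw [show ((2 : ℂ) * a) = ((2 * a : ℝ) : ℂ) by push_cast; ring, Complex.norm_real,
      Real.norm_of_nonneg (by positivity)]
  have hs' : Summable fun n : {n // n ∉ modes N} ↦
      ‖Yoshida1992.fourierCoeff a n φ / (2 * a) * cexp (π * I * n * x / a)‖ := by
    simp_rw [hnorm]
    exact (hsum.div_const (2 * a)).subtype _
  rw [show φ x - trigPoly a N φ x =
      ∑' n : {n // n ∉ modes N}, Yoshida1992.fourierCoeff a n φ / (2 * a) * cexp (π * I * n * x / a) from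
    by rw [hcompl.tsum_eq]; rfl]
  refine (norm_tsum_le_tsum_norm hs').trans (le_of_eq ?_)
  exact tsum_congr fun n ↦ hnorm n

/-- **The window dictionary for the summable class.**  Let `a > 0` and `φ : ℝ → ℂ` vanish off `[−a, a]`, be
continuous on the closed window with `φ(−a) = φ(a)`, and have window Fourier coefficients with `Σ|c_n| < ∞` and
`Σ|n|·|c_n| < ∞`.  Then the truncated Fourier series `proj a N φ` is a window family in the sense of
`tendsto_weilWindowForm_of_uniform`, hence `weilWindowForm a (proj a N φ) → weilWindowForm a φ`.  (Covers the
window polynomials `p·𝟙_{[−a,a]}` with `C¹` periodisation used as deflation profiles of design C∞, and every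
`φ ∈ K(a)` — cf. `tendsto_weilWindowForm_proj`.) -/
theorem tendsto_weilWindowForm_proj_of_summable (ha : 0 < a) (hz : ∀ x, x ∉ Icc (-a) a → φ x = 0)
    (hcont : ContinuousOn φ (Icc (-a) a)) (hend : φ (-a) = φ a)
    (hsum0 : Summable fun n : ℤ ↦ ‖Yoshida1992.fourierCoeff a n φ‖)
    (hsum1 : Summable fun n : ℤ ↦ |(n : ℝ)| ^ 1 * ‖Yoshida1992.fourierCoeff a n φ‖) :
    Tendsto (fun N ↦ weilWindowForm a (proj a N φ)) atTop (𝓝 (weilWindowForm a φ)) := by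
  have hcontp : ∀ N, Continuous (trigPoly a N φ) := fun N ↦
    continuous_finsetSum _ fun n _ ↦ continuous_const.mul
      (Complex.continuous_exp.comp ((continuous_const.mul Complex.continuous_ofReal).div_const _))
  refine tendsto_weilWindowForm_of_uniform (u := fun N ↦ proj a N φ)
    (S₀ := ∑' n : ℤ, ‖Yoshida1992.fourierCoeff a n φ‖ / (2 * a))
    (S₁ := (π / a / (2 * a)) * ∑' n : ℤ, |(n : ℝ)| ^ 1 * ‖Yoshida1992.fourierCoeff a n φ‖)
    (δ := fun N ↦ ∑' n : {n // n ∉ modes N}, ‖Yoshida1992.fourierCoeff a n φ‖ / (2 * a))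
    ha (fun N ↦ ?_) (fun N x hx ↦ proj_apply_of_not_mem ha N φ hx) (fun N x ↦ ?_)
    (fun N x y hx hy ↦ ?_) (fun N x ↦ ?_) (tendsto_tsum_compl_modes a φ)
  · have : proj a N φ = (Icc (-a) a).indicator (trigPoly a N φ) :=
      funext fun x ↦ proj_apply_eq_indicator_trigPoly ha N φ x
    rw [this]
    exact (hcontp N).measurable.indicator measurableSet_Icc
  · by_cases hx : x ∈ Icc (-a) a
    · rw [proj_apply_of_mem ha N φ hx]
      exact norm_trigPoly_le ha hsum0 N x
    · rw [proj_apply_of_not_mem ha N φ hx, norm_zero]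
      exact tsum_nonneg fun n ↦ by positivity
  · rw [proj_apply_of_mem ha N φ hx, proj_apply_of_mem ha N φ hy]
    exact norm_trigPoly_sub_le (fun z ↦ norm_trigPolyDeriv_le ha hsum1 N z) x y
  · by_cases hx : x ∈ Icc (-a) a
    · rw [proj_apply_of_mem ha N φ hx, norm_sub_rev]
      exact norm_sub_trigPoly_le_of_summable ha hcont hend hsum0 N hx
    · rw [proj_apply_of_not_mem ha N φ hx, hz x hx, sub_zero, norm_zero]
      exact tsum_nonneg fun n ↦ by positivity

end Summit.RiemannHypothesis.RiemannHypothesis.Theorems.WeilFormatC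

end
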